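import Summits.Ventures.PercRepro.RankLevelSetExplicitLin2LargeSharp58
import Summits.Ventures.PercRepro.RankLevelSetExplicitLin2TailOptimal

/-!
# PercRepro — THE LEVEL FROM ANY KEY ROW OVER THE CORANKS OF ANY FLAT BOUND (p9, S4)

`proofs/SUBCLAIM-S4-p9.md` §S4.2⁗⁗. THE 5/8 RANGE (RankLevelSetExplicitLin2LargeSharp58 / TailOptimal58) is the instance
`B = 5·2^{q−3} − 1` of one mechanism: if every set of rank `≤ j ≤ q` of the `e`-free core has at most `B − q + j` points
(the flat family of p7's `core_all_corank_of_bound_key`), the large-corank theorem closes the core coranks `> q + B + 1`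
from the bases `N₁` (regime one, `8(q+1)·2^{B−q}·n^q ≤ 2^n`), `P₂` (regime two) and `B + 2 ≤ p`, and the rows need only the
coranks `q + 1 ≤ d ≤ q + B + 1`, with the `(Y)`-tail evaluated at `D = q + B + 1`. Here the flat family is a HYPOTHESIS
(`hflat`), so that every sharper flat bound of the cell — mine-4's `f(r) = C(r+1, 2)` for `r ≤ 5`, the cover recursion from
any base — feeds the rows without a new level theorem:

* `c025_core_explicit_large_of_bound` — the `e`-free core of corank `> q + B + 1` from the bases and the flat family;
* `c025_level_succ_of_key_row_tailOpt_of_bound` — p4's optimal-Chernoff level theorem (`tail_of_optimal_chernoff`, `tail_up`,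
  `tail_down` of RankLevelSetExplicitLin2TailOptimal, unchanged) over the coranks `q + 2 ≤ d ≤ q + 2 + B` at level `q + 1`
  (`B` the level-`(q+1)` flat bound), the pair at the top corank `D = q + 2 + B`.
`c025_level_succ_of_key_row_tailOpt58` is the case `B = 5·2^{q−2} − 1` (with `flat_family_five_two_pow_of_free`).
Axioms: standard.
-/

open scoped Matroid

namespace PercRepro

namespace ThmN

variable {α : Type}

/-- **THE LARGE-CORANK CORE FROM ANY FLAT BOUND**: corank `> q + B + 1`, `p ≥ N₁` (regime one from `N₁` with `2^{B−q}`),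
`p ≥ P₂` (regime two from `P₂`), `B + 2 ≤ p`, and the flat family `|X| + q ≤ B + j` for `ρ(X) ≤ j ≤ q` —
p7's `core_all_corank_of_bound_key` with the regime-two key from `choose_mul_le_choose_mul_of_threshold`. -/
theorem c025_core_explicit_large_of_bound (q B : ℕ) (hq : 2 ≤ q) (hqB : q ≤ B) (N₁ P₂ : ℕ)
    (hN₁ : ∀ n, N₁ ≤ n → 8 * (q + 1) * 2 ^ (B - q) * n ^ q ≤ 2 ^ n)
    (hP₂ : ∀ p, P₂ ≤ p → 2 ^ (p + q) * 2 ^ (B - q) * (2 * (p - 1 - q) + 1) ≤ 4 ^ (p - 1 - q))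
    (M : Matroid α) [M.Finite] (p : ℕ) (hp : N₁ ≤ p) (hp2 : P₂ ≤ p) (hp3 : B + 2 ≤ p)
    (hR : M.eRank = (p : ℕ∞)) (hbig : p + q + B + 1 < M.E.ncard)
    (hfree : ∀ e ∈ M.E, ∃ A ⊆ M.E \ {e}, e ∉ M.closure A ∧ e ∉ M.closure ((M.E \ {e}) \ A))
    (hflat : ∀ j, j ≤ q → ∀ X ⊆ M.E, M.eRk X ≤ j → X.ncard + q ≤ B + j) :
    RLS M p q := by
  refine core_all_corank_of_bound_key q B hq hqB N₁ hN₁ M p hp3 (by omega) ?_ hR hbig hfree hflat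
  intro n hn
  exact choose_mul_le_choose_mul_of_threshold n p q (2 ^ (B - q)) (by omega) hn (hP₂ p hp2)

/-- **THE LEVEL FROM ONE EVALUATED ROW OVER THE CORANKS OF ANY FLAT BOUND, WITH THE OPTIMAL PAIR AT THEIR TOP**: level
`q + 1` with the flat family `hflat` (`|X| + (q+1) ≤ B + j` for `ρ(X) ≤ j ≤ q + 1`, every `e`-free finite matroid) —
the core coranks `q + 2 ≤ d ≤ q + 2 + B` carry the row `K p₀ d` and the tail from the optimal Chernoff pair at
`D = q + 2 + B` (`n₀ = p₀ + D`, `K₀ = q + 1 + D`, `2K₀ ≤ n₀`); the coranks beyond are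
`c025_core_explicit_large_of_bound` from the bases `N₁ ≤ p₀` (`2(q+1) ≤ N₁`, kernel `hbase₁`), `P₂ ≤ p₀` (`q + 3 ≤ P₂`,
kernel `hbase₂`) and `B + 2 ≤ p₀`. -/
theorem c025_level_succ_of_key_row_tailOpt_of_bound (q B : ℕ) (hq : 7 ≤ q) (hqB : q + 1 ≤ B)
    (hflat : ∀ (M : Matroid α) [M.Finite],
      (∀ e ∈ M.E, ∃ A ⊆ M.E \ {e}, e ∉ M.closure A ∧ e ∉ M.closure ((M.E \ {e}) \ A)) →
      ∀ j, j ≤ q + 1 → ∀ X ⊆ M.E, M.eRk X ≤ j → X.ncard + (q + 1) ≤ B + j)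
    (p₀ N₁ P₂ : ℕ) (K : ℕ → ℕ → Prop)
    (hN₁ : N₁ ≤ p₀) (hm : 2 * (q + 1) ≤ N₁)
    (hbase₁ : 8 * (q + 1 + 1) * 2 ^ (B - (q + 1)) * N₁ ^ (q + 1) ≤ 2 ^ N₁)
    (hP₂ : P₂ ≤ p₀) (hP₂q : q + 1 + 2 ≤ P₂)
    (hbase₂ : 2 ^ (P₂ + (q + 1)) * 2 ^ (B - (q + 1)) * (2 * (P₂ - 1 - (q + 1)) + 1) ≤ 4 ^ (P₂ - 1 - (q + 1)))
    (hp3 : B + 2 ≤ p₀)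
    (hK₀ : 2 * (q + 1 + (q + 2 + B)) ≤ p₀ + (q + 2 + B))
    (htop : 16 * (p₀ + (q + 2 + B)) ^ (p₀ + (q + 2 + B)) ≤
      2 ^ (p₀ + (q + 2 + B)) *
        ((p₀ + (q + 2 + B) - (q + 1 + (q + 2 + B))) ^ (p₀ + (q + 2 + B) - (q + 1 + (q + 2 + B))) *
          (q + 1 + (q + 2 + B)) ^ (q + 1 + (q + 2 + B))))
    (hmono : ∀ p d, q + 1 ≤ d → K p d → K (p + 1) d)
    (hcore : ∀ (M : Matroid α) [M.Finite] (p d : ℕ), q + 2 ≤ d → d ≤ q + 2 + B →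
      16 * ∑ j ∈ Finset.range (q + 1 + d + 1), (p + d).choose j ≤ 2 ^ (p + d) →
      K p d → M.eRank = (p : ℕ∞) → M.E.ncard = p + d →
      (∀ e ∈ M.E, ∃ A ⊆ M.E \ {e}, e ∉ M.closure A ∧ e ∉ M.closure ((M.E \ {e}) \ A)) → RLS M p (q + 1))
    (hrow : ∀ t < B + 1, K p₀ (q + 2 + t))
    (hprev : ∀ (M : Matroid α) [M.Finite] (p : ℕ), p₀ - 1 ≤ p → RLS M p q) :
    ∀ (M : Matroid α) [M.Finite] (p : ℕ), p₀ ≤ p → RLS M p (q + 1) := by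
  intro M _ p hp
  -- the tail at the top corank `D = q + 2 + B` from the optimal pair, then at every `p ≥ p₀` and every smaller corank
  have htail0 := Explicit.tail_of_optimal_chernoff (p₀ + (q + 2 + B)) (q + 1 + (q + 2 + B)) hK₀ htop
  have htailp := Explicit.tail_up p₀ (q + 1) (q + 2 + B) htail0 p hp
  have htaild := Explicit.tail_down p (q + 1) (q + 2 + B) htailp
  refine rls_succ_large_at (α := α) q (q + 1) p (by omega) (fun M' _ => hprev M' (p - 1) (by omega)) ?_ ?_ M
  · intro M' _ hn
    rcases Nat.lt_or_ge M'.E.ncard (p + (q + 1)) with h | h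
    · exact RLS_of_ncard_lt M' h
    · exact RLS_of_ncard_eq M' (by omega)
  · intro M' _ hR hbig hfree
    rcases Nat.lt_or_ge M'.E.ncard (p + (q + 1) + B + 2) with h | h
    · have hkey0 := hrow (M'.E.ncard - p - (q + 2)) (by omega)
      rw [show q + 2 + (M'.E.ncard - p - (q + 2)) = M'.E.ncard - p by omega] at hkey0
      have hkey := key_mono_of_succ K (M'.E.ncard - p) (fun p' => hmono p' (M'.E.ncard - p) (by omega)) p₀ p hp hkey0
      have hT := htaild (M'.E.ncard - p) (by omega)
      exact hcore M' p (M'.E.ncard - p) (by omega) (by omega) hT hkey hR (by omega) hfree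
    · exact c025_core_explicit_large_of_bound (q + 1) B (by omega) hqB N₁ P₂
        (Explicit.regime_one_of_base' (q + 1) (8 * (q + 1 + 1) * 2 ^ (B - (q + 1))) N₁ hm hbase₁)
        (Explicit.regime_two_of_base_exp (q + 1) (B - (q + 1)) P₂ hP₂q hbase₂) M' p (hN₁.trans hp) (hP₂.trans hp)
        (hp3.trans hp) hR (by omega) hfree (hflat M' hfree)

end ThmN

end PercRepro
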